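import Summits.ResolutionOfSingularities.ResolutionOfSingularities.Theorems.FrobeniusLadderFRationalResolutionToricWeightZero
import Summits.ResolutionOfSingularities.ResolutionOfSingularities.Theorems.FrobeniusLadderFRationalResolutionToricResolution
import Mathlib.RingTheory.MvPolynomial.WeightedHomogeneous
import Mathlib.RingTheory.RegularLocalRing.Polynomial
import Mathlib.AlgebraicGeometry.Morphisms.Etale
import Mathlib.Algebra.DirectSum.Internal
import HarnessLib

/-!
# Toric surface programme: `U(r,a)` is a diagonalizable quotient singularity in the exact sense of the redirect line

Support file for crux stmt-ResolutionOfSingularities-15317 (`FrobeniusLadder.FRationalResolution`), line `redirect`,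
lead c4. The redirect line's endgame stub `stub_diagonalizableQuotientResolution` asks for a resolution of every integral
separated finite-type `X/k` every point of which lies in the image of an étale `k`-morphism `Spec S₀ → X`, `S` a
finitely generated REGULAR `k`-algebra graded by a finite abelian group `A`, `S₀` its degree-`0` part. This file shows
that the affine toric surfaces `U(r,a) = Spec TA[r,a]` (`1 ≤ r`) carry such charts GLOBALLY and for EVERY field:
`A = ℤ/r`, `S = k[X₀, X₁]` with the weight grading `(a, 1)` (`MvPolynomial.weightedGradedAlgebra`), and
`S₀ ≅ TA[r,a]` (`stub_toric_weightZero`: the lattice embedding `χᵐ ↦ X₀^(m₂) X₁^(r m₁ − a m₂)` identifies `TA[r,a]` with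
the span of the monomials of weight `0`), the chart being that isomorphism — i.e. `U(r,a) = 𝔸² / μ_r`, `μ_r` acting with
weights `(a, 1)`, also in the wild case `p ∣ r`. Consequently `hasResolution_toricSurface` (…ToricResolution.lean) IS the
conclusion of `stub_diagonalizableQuotientResolution` on this two-parameter family, proved unconditionally and over all
fields (`toricSurface_diagonalizableQuotientResolution`).

All folklore (CLS 2011 §1.3, Ex. 1.3.20; §10.1); no published fact is used.
-/

-- single-problem summit: the doubled namespace component is forced
set_option linter.dupNamespace false

noncomputable section

namespace Summit.ResolutionOfSingularities.ResolutionOfSingularities.Theorems.FRationalResolution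

open CategoryTheory AlgebraicGeometry TopologicalSpace
open Literature.AlgebraicGeometry.Resolution

section Toric

variable (k : Type) [Field k]

/-- The Laurent polynomial ring `k[ℤ²]` (coordinate ring of the 2-torus). -/
local notation3 "Lk" => AddMonoidAlgebra k (ℤ × ℤ)

/-- The lattice points of the dual cone `σ∨ = {m₂ ≥ 0, a m₂ ≤ r m₁}` of `σ = cone((0,1),(r,-a))`. -/
local notation3 "σS[" r ", " a "]" =>
  {m : ℤ × ℤ | 0 ≤ m.2 ∧ ((a : ℕ) : ℤ) * m.2 ≤ ((r : ℕ) : ℤ) * m.1}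

/-- The toric surface algebra `k[σ∨ ∩ ℤ²] ⊆ k[ℤ²]`. -/
local notation3 "TA[" r ", " a "]" =>
  Algebra.adjoin k ((fun m : ℤ × ℤ => AddMonoidAlgebra.single m (1 : k)) '' σS[r, a])

/-- Weight `0` for the `ℤ/r`-weighting `(a, 1)` of `k[X₀, X₁]` means `r ∣ a d₀ + d₁` on exponents. [folklore] -/
theorem toric_weight_eq_zero_iff (r a : ℕ) [NeZero r] (d : Fin 2 →₀ ℕ) :
    Finsupp.weight (![((a : ℕ) : ZMod r), 1] : Fin 2 → ZMod r) d = 0 ↔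
      (r : ℤ) ∣ (a : ℤ) * (d 0 : ℕ) + (d 1 : ℕ) := by
  rw [Finsupp.weight_apply, Finsupp.sum_fintype _ _ (fun i => by simp), Fin.sum_univ_two]
  simp only [Matrix.cons_val_zero, Matrix.cons_val_one, nsmul_eq_mul, mul_one]
  rw [← ZMod.intCast_zmod_eq_zero_iff_dvd]
  push_cast
  ring_nf

/-- **`TA[r,a]` is the degree-`0` part of `k[X₀, X₁]` for the `ℤ/r`-grading with weights `(a,1)`**, as `k`-algebras
(`stub_toric_weightZero` + the weight computation). [folklore; CLS2011 Ex. 1.3.20] -/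
theorem toric_algEquiv_weightZero (r a : ℕ) (hr : 1 ≤ r) :
    haveI : NeZero r := ⟨by omega⟩
    letI := MvPolynomial.weightedGradedAlgebra k (![((a : ℕ) : ZMod r), 1] : Fin 2 → ZMod r)
    Nonempty (↥TA[r, a] ≃ₐ[k]
      ↥(SetLike.GradeZero.subalgebra (MvPolynomial.weightedHomogeneousSubmodule k
        (![((a : ℕ) : ZMod r), 1] : Fin 2 → ZMod r)))) := by
  haveI : NeZero r := ⟨by omega⟩
  letI := MvPolynomial.weightedGradedAlgebra k (![((a : ℕ) : ZMod r), 1] : Fin 2 → ZMod r)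
  obtain ⟨ε, hεinj, hεrange⟩ := stub_toric_weightZero k r a hr
  set B := SetLike.GradeZero.subalgebra (MvPolynomial.weightedHomogeneousSubmodule k
    (![((a : ℕ) : ZMod r), 1] : Fin 2 → ZMod r)) with hB
  have hmemB : ∀ f : MvPolynomial (Fin 2) k, f ∈ B ↔ ∀ d ∈ f.support, (r : ℤ) ∣ (a : ℤ) * (d 0 : ℕ) + (d 1 : ℕ) := by
    intro f
    change f ∈ MvPolynomial.weightedHomogeneousSubmodule k _ (0 : ZMod r) ↔ _
    rw [MvPolynomial.mem_weightedHomogeneousSubmodule]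
    constructor
    · intro h d hd
      exact (toric_weight_eq_zero_iff r a d).mp (h (MvPolynomial.mem_support_iff.mp hd))
    · intro h d hd
      exact (toric_weight_eq_zero_iff r a d).mpr (h d (MvPolynomial.mem_support_iff.mpr hd))
  have hεmem : ∀ t : ↥TA[r, a], ε t ∈ B := fun t => (hmemB _).mpr ((hεrange _).mp ⟨t, rfl⟩)
  let ε' : ↥TA[r, a] →ₐ[k] ↥B := ε.codRestrict B hεmem
  refine ⟨AlgEquiv.ofBijective ε' ⟨fun t₁ t₂ h => hεinj (congrArg Subtype.val h), fun f => ?_⟩⟩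
  obtain ⟨t, ht⟩ := (hεrange f.1).mpr ((hmemB f.1).mp f.2)
  exact ⟨t, Subtype.ext ht⟩

/-- **EVERY AFFINE TORIC SURFACE IS A DIAGONALIZABLE QUOTIENT SINGULARITY IN THE SENSE OF THE REDIRECT LINE**: for
`1 ≤ r` and every field `k`, every point of `U(r,a)` lies in the image of an étale `k`-morphism (indeed an
isomorphism) from `Spec` of the degree-`0` part of the finitely generated regular `k`-algebra `k[X₀, X₁]` graded by
the finite abelian group `ℤ/r` with weights `(a, 1)` — verbatim the hypothesis `hq` of
`stub_diagonalizableQuotientResolution` for `X = U(r,a)`, `g` its structure morphism. [folklore; CLS2011 Ex. 1.3.20] -/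
theorem toricSurface_diagonalizableQuotient (r a : ℕ) (hr : 1 ≤ r) :
    ∀ z : Spec (CommRingCat.of ↥TA[r, a]), ∃ (A : Type) (_ : AddCommGroup A) (_ : Finite A) (_ : DecidableEq A)
        (S : Type) (_ : CommRing S) (_ : Algebra k S) (𝒮 : A → Submodule k S)
        (_ : GradedAlgebra 𝒮), Algebra.FiniteType k S ∧ IsRegularRing S ∧
        ∃ φ : Spec (.of (𝒮 0)) ⟶ Spec (CommRingCat.of ↥TA[r, a]), Etale φ ∧ z ∈ Set.range φ ∧
          φ ≫ Spec.map (CommRingCat.ofHom (algebraMap k ↥TA[r, a])) =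
            Spec.map (CommRingCat.ofHom (algebraMap k (𝒮 0))) := by
  haveI : NeZero r := ⟨by omega⟩
  letI := MvPolynomial.weightedGradedAlgebra k (![((a : ℕ) : ZMod r), 1] : Fin 2 → ZMod r)
  intro z
  obtain ⟨e⟩ := toric_algEquiv_weightZero k r a hr
  refine ⟨ZMod r, inferInstance, inferInstance, inferInstance, MvPolynomial (Fin 2) k, inferInstance, inferInstance,
    MvPolynomial.weightedHomogeneousSubmodule k (![((a : ℕ) : ZMod r), 1] : Fin 2 → ZMod r),
    MvPolynomial.weightedGradedAlgebra k _, inferInstance, inferInstance, ?_⟩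
  -- the chart: `Spec` of the `k`-algebra isomorphism `TA[r,a] ≅ S₀`
  let ι : CommRingCat.of ↥TA[r, a] ≅ CommRingCat.of ↥(SetLike.GradeZero.subalgebra
      (MvPolynomial.weightedHomogeneousSubmodule k (![((a : ℕ) : ZMod r), 1] : Fin 2 → ZMod r))) :=
    e.toRingEquiv.toCommRingCatIso
  refine ⟨Spec.map ι.hom, inferInstance, ?_, ?_⟩
  · exact (inferInstance : Surjective (Spec.map ι.hom)).1 z |>.imp fun _ h => h
  · rw [← Spec.map_comp]
    congr 1
    ext c : 2
    exact e.commutes c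

/-- **CONSISTENCY OF THE TORIC PROGRAMME WITH THE REDIRECT ENDGAME**: on the affine toric surfaces the conclusion of
`stub_diagonalizableQuotientResolution` — whose hypothesis they satisfy by `toricSurface_diagonalizableQuotient` — holds
unconditionally and over every field (`hasResolution_toricSurface`). [folklore] -/
theorem toricSurface_diagonalizableQuotientResolution (r a : ℕ) (har : a < r) :
    (∀ z : Spec (CommRingCat.of ↥TA[r, a]), ∃ (A : Type) (_ : AddCommGroup A) (_ : Finite A) (_ : DecidableEq A)
        (S : Type) (_ : CommRing S) (_ : Algebra k S) (𝒮 : A → Submodule k S)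
        (_ : GradedAlgebra 𝒮), Algebra.FiniteType k S ∧ IsRegularRing S ∧
        ∃ φ : Spec (.of (𝒮 0)) ⟶ Spec (CommRingCat.of ↥TA[r, a]), Etale φ ∧ z ∈ Set.range φ ∧
          φ ≫ Spec.map (CommRingCat.ofHom (algebraMap k ↥TA[r, a])) =
            Spec.map (CommRingCat.ofHom (algebraMap k (𝒮 0)))) ∧
      Scheme.HasResolution (Spec (CommRingCat.of ↥TA[r, a])) :=
  ⟨toricSurface_diagonalizableQuotient k r a (by omega), hasResolution_toricSurface k r a har⟩

end Toric

end Summit.ResolutionOfSingularities.ResolutionOfSingularities.Theorems.FRationalResolution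

end
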